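import Summits.NavierStokesRegularity.NavierStokesRegularity.Theorems.LerayQuarterDissipationFiniteDissipationLiouvilleApexPressure
import HarnessLib

/-!
# Crux `FiniteDissipationLiouville` (stmt-NavierStokesRegularity-22144): the SLICE bound of the gauged
# pressure of a member of the finite-dissipation stratum, at the Type-I rate

Theorems file of route `LerayQuarterDissipation` (lead prover g3; `--supports` the crux). Navier–Stokes
regularity is NOT proved by anything here; no summit is.

`…ApexPressure.lean` (`exists_normalised_pressure`) records only the space–time class
`p ∈ L^{3/2}((−T,0) × B(0,R))` of the gauged Calderón–Zygmund pressure of a member of the stratum.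
Its proof in fact gives the SLICE bound at the Type-I rate, which this file exports
(`exists_normalised_pressure_sliceBound`): one smooth gauge, classical on the whole past, and for all
`T, R > 0` a constant `D` with

  `∫_{B(0,R)} |p(t)|^{3/2} ≤ D (−t)^{−3/4}`   for `t ∈ (−T, 0)`

(`3κ = 3/4` with Chae–Wolf's `κ = (q−3)/(2q)`, `q = 6`). It is the input of the RATE at which the
distributional trace at the apex is attained (`…TraceRate.lean`).

References: D. Chae, J. Wolf, arXiv:1610.09464, §2 Step 2 (2.4b); T. Tao, Anal. PDE 6 (2013),
Lemma 4.1 (i) (pressure normalisation).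
-/

noncomputable section

-- the summit and its single sub-problem share the name (CONVENTIONS §1), as in every Theorems file
set_option linter.dupNamespace false

namespace Summit.NavierStokesRegularity.NavierStokesRegularity.Theorems.FiniteDissipationLiouville.Birth.Apex

open MeasureTheory Set Filter Topology Metric Function
open Literature.Analysis Literature.Analysis.FluidPDE
open scoped ENNReal NNReal ContDiff

variable {C K : ℝ} {u : ℝ → EuclideanSpace ℝ (Fin 3) → EuclideanSpace ℝ (Fin 3)}

/-- **The slice bound of the gauged pressure at the Type-I rate.** A member of the stratum is a
classical Navier–Stokes solution on `(−∞, 0) × ℝ³` for ONE smooth pressure `p` with, for all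
`T, R > 0`, `∫_{B(0,R)} |p(t)|^{3/2} ≤ D (−t)^{−3/4}` on `(−T, 0)` (the slice form of
`exists_normalised_pressure`; same gauge, same proof). -/
theorem exists_normalised_pressure_sliceBound (hu : IsTypeIAncientMild C u)
    (hlaw : ∀ s : ℝ, s < 0 → ∫⁻ x, ‖fderiv ℝ (u s) x‖ₑ ^ 2 ≤ ENNReal.ofReal (K / Real.sqrt (-s))) :
    ∃ p : ℝ → EuclideanSpace ℝ (Fin 3) → ℝ, IsClassicalNSSolutionOn (Iio 0) 1 0 u p ∧
      ∀ (T R : ℝ), 0 < T → 0 < R → ∃ D : ℝ, 0 ≤ D ∧ ∀ t ∈ Ioo (-T) 0,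
        ∫⁻ x in ball (0 : EuclideanSpace ℝ (Fin 3)) R, ‖p t x‖ₑ ^ (3 / 2 : ℝ) ≤
          ENNReal.ofReal (D * (-t) ^ (-(3 * ((6 - 3) / (2 * 6) : ℝ)))) := by
  obtain ⟨p₀, hsol⟩ := exists_isClassicalNSSolutionOn_Iio hu
  obtain ⟨A, hA0, hA⟩ := exists_eLpNorm_six_rate hu hlaw
  -- the fixed normaliser at scale `1`
  let θ₁ : ContDiffBump (0 : EuclideanSpace ℝ (Fin 3)) := ⟨1 / 2, 1, by norm_num, by norm_num⟩
  have hθ₁ : θ₁.rOut = 1 := rfl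
  obtain ⟨m₀, hm₀, hm₀val⟩ := ChaeWolfEnergy.exists_smooth_normaliser hsol isOpen_Iio 0 θ₁
  refine ⟨fun t x => p₀ t x - m₀ t, isClassicalNSSolutionOn_sub_normaliser hsol hm₀,
    fun T R _ hR => ?_⟩
  set κ : ℝ := (6 - 3) / (2 * 6) with hκ
  have hκ0 : 0 ≤ κ := by rw [hκ]; norm_num
  have hκ3 : 3 * κ < 1 := by rw [hκ]; norm_num
  have hq2 : (2 : ℝ) < 6 := by norm_num
  have hq3 : (3 : ℝ) ≤ 6 := by norm_num
  have hLq : ∀ t ∈ Ioo (-T) 0, MemLp (u t) (ENNReal.ofReal 6) volume := fun t ht => (hA t ht.2).1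
  have hrate : ∀ t ∈ Ioo (-T) 0,
      eLpNorm (u t) (ENNReal.ofReal 6) volume ≤ ENNReal.ofReal (A * (-t) ^ (-κ)) :=
    fun t ht => (hA t ht.2).2
  -- slice pressures
  obtain ⟨Cq, hQex⟩ := ChaeWolfEnergy.exists_rieszPressure_slice_of_rate hsol hq2 hκ0 hA0 hLq hrate
  choose! Qt hQt hQtb hQteq Ct hCt using hQex
  -- the normaliser at scale `R`
  let θR : ContDiffBump (0 : EuclideanSpace ℝ (Fin 3)) := ⟨R / 2, R, by positivity, by linarith⟩
  have hθR : θR.rOut = R := rfl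
  obtain ⟨mR, -, hmRval⟩ := ChaeWolfEnergy.exists_smooth_normaliser hsol isOpen_Iio 0 θR
  -- sup bounds of the normed bumps
  set BR : ℝ := 1 / (volume : Measure (EuclideanSpace ℝ (Fin 3))).real
    (closedBall (0 : EuclideanSpace ℝ (Fin 3)) θR.rIn) with hBR
  have hBRle : ∀ y, θR.normed volume y ≤ BR := fun y =>
    θR.normed_le_div_measure_closedBall_rIn volume y
  have hBR0 : 0 ≤ BR := (θR.nonneg_normed 0).trans (hBRle 0)
  set B1 : ℝ := 1 / (volume : Measure (EuclideanSpace ℝ (Fin 3))).real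
    (closedBall (0 : EuclideanSpace ℝ (Fin 3)) θ₁.rIn) with hB1
  have hB1le : ∀ y, θ₁.normed volume y ≤ B1 := fun y =>
    θ₁.normed_le_div_measure_closedBall_rIn volume y
  have hB10 : 0 ≤ B1 := (θ₁.nonneg_normed 0).trans (hB1le 0)
  -- constants
  set Vc : ℝ := (volume : Measure (EuclideanSpace ℝ (Fin 3))).real
    (closedBall (0 : EuclideanSpace ℝ (Fin 3)) R) with hVc
  set Vb : ℝ := (volume : Measure (EuclideanSpace ℝ (Fin 3))).real
    (ball (0 : EuclideanSpace ℝ (Fin 3)) R) with hVb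
  set V1 : ℝ := (volume : Measure (EuclideanSpace ℝ (Fin 3))).real
    (closedBall (0 : EuclideanSpace ℝ (Fin 3)) 1) with hV1
  have hVc0 : 0 ≤ Vc := measureReal_nonneg
  have hVb0 : 0 ≤ Vb := measureReal_nonneg
  have hV10 : 0 ≤ V1 := measureReal_nonneg
  set E : ℝ := BR * Vc ^ (1 - 2 / 6 : ℝ) + B1 * V1 ^ (1 - 2 / 6 : ℝ) with hE
  have hE0 : 0 ≤ E := by positivity
  set G : ℝ := (Cq : ℝ) ^ (3 / 2 : ℝ) * A ^ 3 with hG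
  have hG0 : 0 ≤ G := by positivity
  set D : ℝ := (2 : ℝ) ^ (1 / 2 : ℝ) * ((2 : ℝ) ^ (1 / 2 : ℝ) *
      (Vc ^ (1 - 3 / 6 : ℝ) * G + Vb * ((BR * Vc ^ (1 - 2 / 6 : ℝ)) ^ (3 / 2 : ℝ) * G)) +
    Vb * (E ^ (3 / 2 : ℝ) * G)) with hD
  have hD0 : 0 ≤ D := by positivity
  -- ### the slice bound
  have hslice : ∀ t ∈ Ioo (-T) 0,
      ∫⁻ x in ball (0 : EuclideanSpace ℝ (Fin 3)) R, ‖p₀ t x - m₀ t‖ₑ ^ (3 / 2 : ℝ) ≤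
        ENNReal.ofReal (D * (-t) ^ (-(3 * κ))) := by
    intro t ht
    have ht0 : 0 < -t := by linarith [ht.2]
    set M : ℝ≥0 := (A * (-t) ^ (-κ)).toNNReal with hM
    have hMval : (M : ℝ) = A * (-t) ^ (-κ) :=
      Real.coe_toNNReal _ (mul_nonneg hA0 (Real.rpow_nonneg ht0.le _))
    have hvM : eLpNorm (u t) (ENNReal.ofReal 6) volume ≤ M := hrate t ht
    set P : ℝ≥0 := Cq * M ^ 2 with hP
    have hQP : eLpNorm (Qt t) (ENNReal.ofReal (6 / 2)) volume ≤ P := by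
      calc eLpNorm (Qt t) (ENNReal.ofReal (6 / 2)) volume
          ≤ Cq * eLpNorm (u t) (ENNReal.ofReal 6) volume ^ 2 := hQtb t ht
        _ ≤ Cq * (M : ℝ≥0∞) ^ 2 := by gcongr
        _ = (P : ℝ≥0∞) := by rw [hP]; push_cast; ring
    have hPval : (P : ℝ) = Cq * (A * (-t) ^ (-κ)) ^ 2 := by
      rw [hP, NNReal.coe_mul, NNReal.coe_pow, hMval]
    have hP0 : 0 ≤ (P : ℝ) := P.coe_nonneg
    obtain ⟨-, -, i32⟩ := ChaeWolfEnergy.rate_pow_identities (κ := κ) hA0 Cq.coe_nonneg ht0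
    have hP32 : (P : ℝ) ^ (3 / 2 : ℝ) = G * (-t) ^ (-(3 * κ)) := by rw [hPval, i32, hG]
    -- (a) the ball bound with the normaliser at scale `R`
    have key := ChaeWolfEnergy.lintegral_ball_pressure_sub_le hq3 0 θR hBRle (hQt t ht) hQP
      (hCt t ht) (hmRval t ht.2)
    rw [hθR] at key
    -- (b) the two normalisers differ by `≤ E P`
    have hdR := abs_normaliser_sub_const_le (q := 6) (by norm_num) 0 θR hBRle (hQt t ht) hQP
      (hCt t ht)
    have hd1 := abs_normaliser_sub_const_le (q := 6) (by norm_num) 0 θ₁ hB1le (hQt t ht) hQP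
      (hCt t ht)
    rw [hθR] at hdR
    rw [hθ₁] at hd1
    have hdiff : |mR t - m₀ t| ≤ E * P := by
      rw [hmRval t ht.2, hm₀val t ht.2]
      calc |(∫ y, θR.normed volume y * p₀ t (0 - y)) - ∫ y, θ₁.normed volume y * p₀ t (0 - y)|
          = |((∫ y, θR.normed volume y * p₀ t (0 - y)) - Ct t) -
              ((∫ y, θ₁.normed volume y * p₀ t (0 - y)) - Ct t)| := by ring_nf
        _ ≤ |(∫ y, θR.normed volume y * p₀ t (0 - y)) - Ct t| +
              |(∫ y, θ₁.normed volume y * p₀ t (0 - y)) - Ct t| := abs_sub _ _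
        _ ≤ BR * (Vc ^ (1 - 2 / 6 : ℝ) * (P : ℝ)) + B1 * (V1 ^ (1 - 2 / 6 : ℝ) * (P : ℝ)) :=
              add_le_add hdR hd1
        _ = E * P := by rw [hE]; ring
    -- (c) the pointwise splitting
    have hsplit : ∀ x, ‖p₀ t x - m₀ t‖ₑ ^ (3 / 2 : ℝ) ≤
        (2 : ℝ≥0∞) ^ (1 / 2 : ℝ) * (‖p₀ t x - mR t‖ₑ ^ (3 / 2 : ℝ) + ‖mR t - m₀ t‖ₑ ^ (3 / 2 : ℝ)) := by
      intro x
      have e : p₀ t x - m₀ t = (p₀ t x - mR t) + (mR t - m₀ t) := by ring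
      rw [e]
      calc ‖(p₀ t x - mR t) + (mR t - m₀ t)‖ₑ ^ (3 / 2 : ℝ)
          ≤ (‖p₀ t x - mR t‖ₑ + ‖mR t - m₀ t‖ₑ) ^ (3 / 2 : ℝ) :=
            ENNReal.rpow_le_rpow (enorm_add_le _ _) (by norm_num)
        _ ≤ _ := add_rpow_threeHalves_le _ _
    -- the constant term
    have hconst : ∫⁻ _ in ball (0 : EuclideanSpace ℝ (Fin 3)) R, ‖mR t - m₀ t‖ₑ ^ (3 / 2 : ℝ) ≤
        ENNReal.ofReal (Vb * (E * (P : ℝ)) ^ (3 / 2 : ℝ)) := by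
      rw [setLIntegral_const, mul_comm, Real.enorm_eq_ofReal_abs,
        ENNReal.ofReal_rpow_of_nonneg (abs_nonneg _) (by norm_num),
        ENNReal.ofReal_mul hVb0, ofReal_measureReal (measure_ball_lt_top).ne]
      gcongr
    have hX0 : 0 ≤ (2 : ℝ) ^ (1 / 2 : ℝ) * (Vc ^ (1 - 3 / 6 : ℝ) * (P : ℝ) ^ (3 / 2 : ℝ) +
        Vb * (BR * (Vc ^ (1 - 2 / 6 : ℝ) * (P : ℝ))) ^ (3 / 2 : ℝ)) := by positivity
    have hY0 : 0 ≤ Vb * (E * (P : ℝ)) ^ (3 / 2 : ℝ) := by positivity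
    -- (d) integrate
    calc ∫⁻ x in ball (0 : EuclideanSpace ℝ (Fin 3)) R, ‖p₀ t x - m₀ t‖ₑ ^ (3 / 2 : ℝ)
        ≤ ∫⁻ x in ball (0 : EuclideanSpace ℝ (Fin 3)) R, (2 : ℝ≥0∞) ^ (1 / 2 : ℝ) *
            (‖p₀ t x - mR t‖ₑ ^ (3 / 2 : ℝ) + ‖mR t - m₀ t‖ₑ ^ (3 / 2 : ℝ)) :=
          lintegral_mono fun x => hsplit x
      _ = (2 : ℝ≥0∞) ^ (1 / 2 : ℝ) *
            ((∫⁻ x in ball (0 : EuclideanSpace ℝ (Fin 3)) R, ‖p₀ t x - mR t‖ₑ ^ (3 / 2 : ℝ)) +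
              ∫⁻ _ in ball (0 : EuclideanSpace ℝ (Fin 3)) R, ‖mR t - m₀ t‖ₑ ^ (3 / 2 : ℝ)) := by
          rw [lintegral_const_mul' _ _ (ENNReal.rpow_ne_top_of_nonneg (by norm_num) ENNReal.ofNat_ne_top),
            lintegral_add_right _ measurable_const]
      _ ≤ (2 : ℝ≥0∞) ^ (1 / 2 : ℝ) *
            (ENNReal.ofReal ((2 : ℝ) ^ (1 / 2 : ℝ) * (Vc ^ (1 - 3 / 6 : ℝ) * (P : ℝ) ^ (3 / 2 : ℝ) +
              Vb * (BR * (Vc ^ (1 - 2 / 6 : ℝ) * (P : ℝ))) ^ (3 / 2 : ℝ))) +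
             ENNReal.ofReal (Vb * (E * (P : ℝ)) ^ (3 / 2 : ℝ))) := by
          gcongr
      _ = ENNReal.ofReal ((2 : ℝ) ^ (1 / 2 : ℝ) *
            ((2 : ℝ) ^ (1 / 2 : ℝ) * (Vc ^ (1 - 3 / 6 : ℝ) * (P : ℝ) ^ (3 / 2 : ℝ) +
              Vb * (BR * (Vc ^ (1 - 2 / 6 : ℝ) * (P : ℝ))) ^ (3 / 2 : ℝ)) +
             Vb * (E * (P : ℝ)) ^ (3 / 2 : ℝ))) := by
          rw [← ENNReal.ofReal_add hX0 hY0, ENNReal.ofReal_mul (by positivity),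
            ← ENNReal.ofReal_rpow_of_nonneg (by norm_num : (0 : ℝ) ≤ 2) (by norm_num),
            ENNReal.ofReal_ofNat]
      _ = ENNReal.ofReal (D * (-t) ^ (-(3 * κ))) := by
          congr 1
          have e1 : (BR * (Vc ^ (1 - 2 / 6 : ℝ) * (P : ℝ))) ^ (3 / 2 : ℝ) =
              (BR * Vc ^ (1 - 2 / 6 : ℝ)) ^ (3 / 2 : ℝ) * (P : ℝ) ^ (3 / 2 : ℝ) := by
            rw [← mul_assoc, Real.mul_rpow (by positivity) hP0]
          have e2 : (E * (P : ℝ)) ^ (3 / 2 : ℝ) = E ^ (3 / 2 : ℝ) * (P : ℝ) ^ (3 / 2 : ℝ) :=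
            Real.mul_rpow hE0 hP0
          rw [e1, e2, hP32, hD]
          ring
  exact ⟨D, hD0, hslice⟩

end Summit.NavierStokesRegularity.NavierStokesRegularity.Theorems.FiniteDissipationLiouville.Birth.Apex

end
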